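import Mathlib
import Literature.Analysis.FluidPDE.ScalarFourierData
import HarnessLib

/-!
# Route KLProgramme — support item R0′ `H10RungCompactBox`, helper 1/4: uniform Fourier decay for
smooth PARAMETER FAMILIES on the flat torus

For the BC5 first rung of crux K1 (`H10RungCompactBox`, item stmt-HubbardSuperconductivity-20034) the
single-scale corner `|U| < r(β, μ)` of the two-point thermodynamic limit
(`Literature.…HubbardTorusTwoPointSmallCoupling`) must be made UNIFORM on compact boxes of `(β, μ)`. The
radius is `r ∝ (β C S)⁻¹` with `C` the decay constant of the free propagator, which the tree obtains
(`HubbardFreePropagatorTorusDecay`) from the ONE-parameter uniform decay lemma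
`ScalarFourier.exists_hasDecay_mFourierCoeff_spaceTime` (time `τ ∈ [0, T]`, joint smoothness
`Torus.IsSmoothSpaceTimeOn`). Here that lemma is re-proved for families indexed by an arbitrary real
normed parameter space `P` (used with `P = ℝ × ℝ × ℝ ∋ (τ, β, μ)`): if
`(p, y) ↦ ψ p (proj y)` is `C^∞` on `S × ℝ^d` (`S` of unique differentiability) then on every compact
`K ⊆ S` the Fourier coefficients of the slices decay to every order with ONE constant,
`paramTorus_exists_hasDecay_mFourierCoeff`. The proofs are those of `Torus.IsSmoothSpaceTimeOn.*`
(`TorusSpaceTime.lean`) and `ScalarFourierData.lean` verbatim with `ℝ` replaced by `P`; no definition is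
introduced (the joint-smoothness hypothesis is spelled out as a `ContDiffOn` on the product).
-/

noncomputable section

-- the tree's namespace `Summit.<Summit>.<Problem>.Theorems` repeats the summit name by design (D-0017)
set_option linter.dupNamespace false

open MeasureTheory Set Filter Topology UnitAddTorus
open scoped ContDiff
open Literature.Analysis.FunctionSpaces
open Literature.Analysis.FunctionSpaces.Torus (proj lift liftAt IsSmooth IsContDiff laplacian partialDeriv
  freqNormSq repr isCompact_toLp_image_pi_Icc repr_mem_toLp_image_pi_Icc)
open Literature.Analysis.FluidPDE.FourierNS (HasDecay)

namespace Summit.HubbardSuperconductivity.HubbardSuperconductivity.Theorems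

variable {d : Type*} [Fintype d]
variable {F : Type*} [NormedAddCommGroup F] [NormedSpace ℝ F]
variable {P : Type*} [NormedAddCommGroup P] [NormedSpace ℝ P]

section Family

variable {S : Set P} {u : P → UnitAddTorus d → F}

/-- A jointly smooth parameter family has smooth slices `u p`, `p ∈ S`. -/
theorem paramTorus_isSmooth_slice
    (hu : ContDiffOn ℝ ∞ (fun z : P × EuclideanSpace ℝ d => u z.1 (proj z.2)) (S ×ˢ univ))
    {p : P} (hp : p ∈ S) : IsSmooth (u p) := by
  change ContDiff ℝ ∞ ((fun z : P × EuclideanSpace ℝ d => u z.1 (proj z.2)) ∘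
    fun y : EuclideanSpace ℝ d => (p, y))
  exact hu.comp_contDiff (contDiff_prodMk_right p) fun y => Set.mk_mem_prod hp (Set.mem_univ y)

omit [Fintype d] [NormedSpace ℝ F] [NormedSpace ℝ P] in
/-- **Uniform bound on compact parameter sets** (tube lemma over the compact torus): a family whose
joint lift is continuous on `S × ℝ^d` is bounded on `K × T^d` for every compact `K ⊆ S`. -/
theorem paramTorus_exists_norm_le_of_isCompact
    (hu : ContinuousOn (fun z : P × EuclideanSpace ℝ d => u z.1 (proj z.2)) (S ×ˢ univ))
    {K : Set P} (hK : IsCompact K) (hKS : K ⊆ S) : ∃ C : ℝ, ∀ p ∈ K, ∀ x, ‖u p x‖ ≤ C := by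
  have hc : ContinuousOn (fun z : P × EuclideanSpace ℝ d => u z.1 (proj z.2))
      (K ×ˢ ((WithLp.toLp 2) '' (Set.pi univ fun _ : d => Icc (0 : ℝ) 1))) :=
    hu.mono (prod_mono hKS (subset_univ _))
  obtain ⟨C, hC⟩ := (hK.prod isCompact_toLp_image_pi_Icc).exists_bound_of_continuousOn hc
  refine ⟨C, fun p hp x => ?_⟩
  have h := hC (p, repr x) (mk_mem_prod hp (repr_mem_toLp_image_pi_Icc x))
  simpa using h

/-- Spatial Fréchet derivatives of the slices through the joint lift:
`D(u p)(proj y) w = D_{S × ℝ^d}(lift)(p, y) (0, w)` for `p ∈ S`. -/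
theorem paramTorus_fderiv_slice_apply
    (hu : ContDiffOn ℝ ∞ (fun z : P × EuclideanSpace ℝ d => u z.1 (proj z.2)) (S ×ˢ univ))
    {p : P} (hp : p ∈ S) (y w : EuclideanSpace ℝ d) :
    Torus.fderiv (u p) (proj y) w =
      fderivWithin ℝ (fun z : P × EuclideanSpace ℝ d => u z.1 (proj z.2)) (S ×ˢ univ) (p, y) (0, w) := by
  have h1 : HasFDerivWithinAt (fun z : P × EuclideanSpace ℝ d => u z.1 (proj z.2))
      (fderivWithin ℝ (fun z : P × EuclideanSpace ℝ d => u z.1 (proj z.2)) (S ×ˢ univ) (p, y))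
      (S ×ˢ univ) (p, y) :=
    (hu.differentiableOn (by simp) (p, y) (mk_mem_prod hp (mem_univ _))).hasFDerivWithinAt
  have h2 : HasFDerivAt (fun z : EuclideanSpace ℝ d => ((p, z) : P × EuclideanSpace ℝ d))
      (ContinuousLinearMap.inr ℝ P (EuclideanSpace ℝ d)) y := hasFDerivAt_prodMk_right p y
  have h3 := h1.comp_hasFDerivAt y h2 (Eventually.of_forall fun z => mk_mem_prod hp (mem_univ _))
  rw [← Torus.fderiv_lift]
  have hcomp : ((fun z : P × EuclideanSpace ℝ d => u z.1 (proj z.2)) ∘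
      fun z : EuclideanSpace ℝ d => ((p, z) : P × EuclideanSpace ℝ d)) = lift (u p) := by
    funext z; rfl
  rw [hcomp] at h3
  rw [h3.fderiv]
  rfl

/-- **Directional spatial derivatives of jointly smooth families are jointly smooth** (on parameter
sets of unique differentiability). -/
theorem paramTorus_lineDeriv
    (hu : ContDiffOn ℝ ∞ (fun z : P × EuclideanSpace ℝ d => u z.1 (proj z.2)) (S ×ˢ univ))
    (hS : UniqueDiffOn ℝ S) (v : EuclideanSpace ℝ d) :
    ContDiffOn ℝ ∞ (fun z : P × EuclideanSpace ℝ d => Torus.lineDeriv (u z.1) (proj z.2) v) (S ×ˢ univ) := by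
  have hU : UniqueDiffOn ℝ (S ×ˢ (univ : Set (EuclideanSpace ℝ d))) := hS.prod uniqueDiffOn_univ
  have hG : ContDiffOn ℝ ∞ (fun z => fderivWithin ℝ (fun z : P × EuclideanSpace ℝ d => u z.1 (proj z.2))
      (S ×ˢ univ) z (0, v)) (S ×ˢ (univ : Set (EuclideanSpace ℝ d))) :=
    (hu.fderivWithin hU le_rfl).clm_apply contDiffOn_const
  refine hG.congr fun z hz => ?_
  obtain ⟨p, y⟩ := z
  have hp : p ∈ S := (mem_prod.1 hz).1
  dsimp only
  rw [Torus.lineDeriv_eq_fderiv_apply ((paramTorus_isSmooth_slice hu hp).isContDiff (by simp)),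
    paramTorus_fderiv_slice_apply hu hp]

variable [DecidableEq d]

/-- Spatial partial derivatives of jointly smooth families are jointly smooth. -/
theorem paramTorus_partialDeriv
    (hu : ContDiffOn ℝ ∞ (fun z : P × EuclideanSpace ℝ d => u z.1 (proj z.2)) (S ×ˢ univ))
    (hS : UniqueDiffOn ℝ S) (i : d) :
    ContDiffOn ℝ ∞ (fun z : P × EuclideanSpace ℝ d => partialDeriv i (u z.1) (proj z.2)) (S ×ˢ univ) :=
  paramTorus_lineDeriv hu hS (EuclideanSpace.single i 1)

/-- Laplacians of jointly smooth families are jointly smooth (`Δ = ∑ᵢ ∂ᵢ∂ᵢ` slice-wise). -/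
theorem paramTorus_laplacian
    (hu : ContDiffOn ℝ ∞ (fun z : P × EuclideanSpace ℝ d => u z.1 (proj z.2)) (S ×ˢ univ))
    (hS : UniqueDiffOn ℝ S) :
    ContDiffOn ℝ ∞ (fun z : P × EuclideanSpace ℝ d => laplacian (u z.1) (proj z.2)) (S ×ˢ univ) := by
  have h : ContDiffOn ℝ ∞ (fun z : P × EuclideanSpace ℝ d =>
      ∑ i, partialDeriv i (partialDeriv i (u z.1)) (proj z.2)) (S ×ˢ univ) :=
    ContDiffOn.sum fun i _ =>
      paramTorus_partialDeriv (u := fun p => partialDeriv i (u p)) (paramTorus_partialDeriv hu hS i) hS i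
  refine ContDiffOn.congr h fun z hz => ?_
  obtain ⟨p, y⟩ := z
  exact Torus.laplacian_eq_sum_partialDeriv_partialDeriv (paramTorus_isSmooth_slice hu (mem_prod.1 hz).1) _

end Family

section Decay

variable [DecidableEq d] {S : Set P} {ψ : P → UnitAddTorus d → ℂ}

/-- Slice-wise elliptic iterates `(1 - (4π²)⁻¹Δ)^n` of a jointly smooth family are jointly smooth. -/
theorem paramTorus_iterate_oneSubLaplacian
    (hψ : ContDiffOn ℝ ∞ (fun z : P × EuclideanSpace ℝ d => ψ z.1 (proj z.2)) (S ×ˢ univ))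
    (hS : UniqueDiffOn ℝ S) (n : ℕ) :
    ContDiffOn ℝ ∞ (fun z : P × EuclideanSpace ℝ d =>
      ((fun b : UnitAddTorus d → ℂ => fun x => b x - (4 * Real.pi ^ 2)⁻¹ • laplacian b x)^[n] (ψ z.1))
        (proj z.2)) (S ×ˢ univ) := by
  induction n generalizing ψ with
  | zero => exact hψ
  | succ n ih =>
    have h1 : ContDiffOn ℝ ∞ (fun z : P × EuclideanSpace ℝ d =>
        (fun p : P => fun x : UnitAddTorus d => ψ p x - (4 * Real.pi ^ 2)⁻¹ • laplacian (ψ p) x) z.1 (proj z.2))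
        (S ×ˢ univ) :=
      hψ.sub ((paramTorus_laplacian hψ hS).const_smul _)
    have h2 := ih (ψ := fun p x => ψ p x - (4 * Real.pi ^ 2)⁻¹ • laplacian (ψ p) x) h1
    simpa only [Function.iterate_succ_apply] using h2

/-- **Uniform polynomial decay of the Fourier coefficients of a jointly smooth parameter family** on a
compact parameter set: for every `N` there is `C` with `‖𝓕(ψ p)(k)‖ ≤ C (1 + ‖k‖)^{-N}` for all
`p ∈ K` (Grafakos, *Classical Fourier Analysis* §3.3.1, with the constant tracked through the compact
parameter). -/
theorem paramTorus_exists_hasDecay_mFourierCoeff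
    (hψ : ContDiffOn ℝ ∞ (fun z : P × EuclideanSpace ℝ d => ψ z.1 (proj z.2)) (S ×ˢ univ))
    (hS : UniqueDiffOn ℝ S) {K : Set P} (hK : IsCompact K) (hKS : K ⊆ S) (N : ℕ) :
    ∃ C : ℝ, 0 ≤ C ∧ ∀ p ∈ K, HasDecay N C (fun k => mFourierCoeff (ψ p) k) := by
  have hit := paramTorus_iterate_oneSubLaplacian hψ hS N
  obtain ⟨M, hM⟩ := paramTorus_exists_norm_le_of_isCompact
    (u := fun p => (fun b : UnitAddTorus d → ℂ => fun x => b x - (4 * Real.pi ^ 2)⁻¹ • laplacian b x)^[N] (ψ p))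
    hit.continuousOn hK hKS
  refine ⟨2 ^ N * max M 0, by positivity, fun p hp => ?_⟩
  have hM' : ∀ x, ‖((fun b : UnitAddTorus d → ℂ => fun x => b x - (4 * Real.pi ^ 2)⁻¹ • laplacian b x)^[N]
      (ψ p)) x‖ ≤ max M 0 := fun x => (hM p hp x).trans (le_max_left _ _)
  exact (Literature.Analysis.FluidPDE.ScalarFourier.hasDecay_of_freqNormSq_bound (le_max_right _ _)
    (Literature.Analysis.FluidPDE.ScalarFourier.norm_mFourierCoeff_le_of_iterate_bound
      (paramTorus_isSmooth_slice hψ (hKS hp)) hM')).of_le (by omega)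

end Decay

end Summit.HubbardSuperconductivity.HubbardSuperconductivity.Theorems

end
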